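import Literature.NumberTheory.QuadraticFields.InfrastructureUnits
import Mathlib.Algebra.Squarefree.Basic
import Mathlib.Data.Nat.Squarefree
import HarnessLib

/-!
# Squaring a frame: the giant step `𝔞 ↦ 𝔞²` of the infrastructure, division-free

Topic `NumberTheory/QuadraticFields` (the infrastructure of a real quadratic order, V), continuing
`InfrastructureMinima.lean` / `InfrastructureUnits.lean`. For a reduced frame `(a, b, θ, θψ)`
(`𝒪 = θℤ + θψℤ`, `ψ = (b + √Δ)/2a`, `β = aψ = (b + √Δ)/2`) the product ideal
`[a, β]² = ⟨a², aβ, β²⟩` is `g[A, β_B]` with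

  `g = gcd(a, b)`, `a = ga'`, `b = gb'`, `A = a'²`, `β_B = β + νa'c`, `B = b + 2νa'c`,

where `μa' + νb' = 1`, `κg + λc = 1`, `c = (Δ - b²)/4a` (Jacobson–Williams §5.4, ideal products;
the classical duplication formulas, Cohen Alg. 5.4.8), because

  `gA = κa² - b'λ·aβ + a'λ·β²`, `gβ_B = μ·aβ + ν·β²`, and conversely
  `a² = g·gA`, `aβ = a'·gβ_B - νc·gA`, `β² = b'·gβ_B + μc·gA`.

Dividing by `a²`: the new frame `sq = (A, B, θ', θ'ψ')` has `θ' = θ²/g`, `ψ' = (B + √Δ)/2A`, its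
coordinate vectors are INTEGER combinations of the coordinate products `θ², θ·θψ, (θψ)²` — so the
step is computable on `θ mod m` without any division (the point of the construction: the fundamental
unit modulo `m` is reached through `θ mod m`, cf. op. cit. §12.3) — and it satisfies the frame
invariant (`Inv.sq`), with `θ' = θ²/g` (`Inv.ev_sq_p`). The new frame is in general not reduced; its
reduction with the distance correction is `InfrastructureReduction.lean`. Also here: `IsFundDisc`
(fundamental discriminants) and the primitivity `gcd(a, b, c) = 1` of every frame of a fundamental
discriminant (`Inv.gcd_gcd_c`), which is what makes `κ, λ` exist.

Everything is proved; no named facts.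

## References

* M. J. Jacobson, Jr., H. C. Williams, *Solving the Pell Equation*, CMS Books in Mathematics, Springer
  (2009), §4.1 (fundamental discriminant, primitive ideals), §5.4 (ideal products), §12.3.
  [JacobsonWilliams2008]
-/

noncomputable section

open scoped Classical

namespace Literature.NumberTheory.QuadraticFields.Infra

variable {Δ : ℕ}

/-! ### Algebra of `lin` and `omul` -/

/-- `lin` of `lin`s. [folklore] -/
theorem lin_lin (x y α β γ δ : ℤ) (u v : ℤ × ℤ) :
    lin x y (lin α β u v) (lin γ δ u v) = lin (x * α + y * γ) (x * β + y * δ) u v := by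
  unfold lin; ext <;> simp only <;> ring

/-- `omul` distributes over `lin` on the right. [folklore] -/
theorem omul_lin (Δ : ℕ) (q : ℤ × ℤ) (x y : ℤ) (p r : ℤ × ℤ) :
    omul Δ q (lin x y p r) = lin x y (omul Δ q p) (omul Δ q r) := by
  unfold omul lin; ext <;> simp only <;> ring

/-- `(1, 0)` is the unit of `omul`. [folklore] -/
theorem omul_one (Δ : ℕ) (p : ℤ × ℤ) : omul Δ p (1, 0) = p := by
  unfold omul; ext <;> simp

/-- Two spanning vectors that lie in the span of `p₂, r₂` make `p₂, r₂` span. [folklore] -/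
theorem Spans.of_mem {u v p₂ r₂ : ℤ × ℤ} (h : Spans u v) {α β γ δ : ℤ} (hu : u = lin α β p₂ r₂)
    (hv : v = lin γ δ p₂ r₂) : Spans p₂ r₂ := by
  intro q
  obtain ⟨x, y, hq⟩ := h q
  exact ⟨x * α + y * γ, x * β + y * δ, by rw [hq, hu, hv, lin_lin]⟩

/-! ### Fundamental discriminants and primitivity -/

/-- **Fundamental discriminant**: `Δ ≠ 1` squarefree with `Δ ≡ 1 (mod 4)`, or `Δ = 4d` with `d`
squarefree, `d ≡ 2, 3 (mod 4)` — the discriminant of the maximal order of `ℚ(√d)`; this is the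
`ℕ`-typed form of `IsFundamentalDiscriminant (Δ : ℤ)` of `QuadraticFields/FundamentalDiscriminant.lean`
restricted to positive discriminants. [cite: JacobsonWilliams2008, §4.1 (Δ_K)] -/
def IsFundDisc (Δ : ℕ) : Prop :=
  (Squarefree Δ ∧ Δ % 4 = 1 ∧ Δ ≠ 1) ∨ (∃ d : ℕ, Δ = 4 * d ∧ Squarefree d ∧ (d % 4 = 2 ∨ d % 4 = 3))

/-- **Primitivity for a fundamental discriminant**: if `b² + 4ac = Δ` then `gcd(a, b, c) = 1` — a
common divisor `q` has `q² ∣ Δ`, and `q = 2` with `Δ = 4d` would force `d ≡ b'² (mod 4)`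
(Jacobson–Williams §4.1: for `Δ = Δ_K` every ideal of `𝒪_K` is invertible / every form primitive).
[cite: JacobsonWilliams2008, §4.1] -/
theorem IsFundDisc.eq_one_of_dvd (hF : IsFundDisc Δ) {a b c : ℤ} (habc : b ^ 2 + 4 * a * c = Δ)
    {q : ℕ} (ha : (q : ℤ) ∣ a) (hb : (q : ℤ) ∣ b) (hc : (q : ℤ) ∣ c) : q = 1 := by
  obtain ⟨a', rfl⟩ := ha
  obtain ⟨b', rfl⟩ := hb
  obtain ⟨c', rfl⟩ := hc
  have hq2 : ((q ^ 2 : ℕ) : ℤ) ∣ (Δ : ℤ) := ⟨b' ^ 2 + 4 * a' * c', by rw [← habc]; push_cast; ring⟩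
  have hq2' : q * q ∣ Δ := by rw [← pow_two]; exact_mod_cast hq2
  rcases hF with ⟨hsf, _, _⟩ | ⟨d, hΔ, hsf, hd⟩
  · exact Nat.isUnit_iff.mp (hsf q hq2')
  · subst hΔ
    rcases Nat.even_or_odd q with ⟨q', hq'⟩ | hodd
    · have h4 : 4 * (q' * q') ∣ 4 * d := by
        have : q * q = 4 * (q' * q') := by rw [hq']; ring
        rwa [this] at hq2'
      have hq'1 : q' = 1 := Nat.isUnit_iff.mp (hsf q' (Nat.dvd_of_mul_dvd_mul_left (by norm_num) h4))
      have hq : q = 2 := by omega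
      subst hq
      have hd' : b' ^ 2 + 4 * a' * c' = d := by
        push_cast at habc
        have h4 : (4 : ℤ) * (b' ^ 2 + 4 * a' * c') = 4 * d := by linear_combination habc
        exact mul_left_cancel₀ (by norm_num : (4 : ℤ) ≠ 0) h4
      rcases Int.even_or_odd b' with ⟨e, he⟩ | ⟨e, he⟩
      · have hK : (d : ℤ) = 4 * (e * e + a' * c') := by rw [← hd', he]; ring
        generalize e * e + a' * c' = K at hK
        omega
      · have hK : (d : ℤ) = 4 * (e * e + e + a' * c') + 1 := by rw [← hd', he]; ring
        generalize e * e + e + a' * c' = K at hK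
        omega
    · have hcop : Nat.Coprime (q * q) 4 := by
        have h2 : Nat.Coprime q 2 := hodd.coprime_two_right
        have : Nat.Coprime (q ^ 2) (2 ^ 2) := Nat.Coprime.pow 2 2 h2
        simpa [pow_two] using this
      exact Nat.isUnit_iff.mp (hsf q (hcop.dvd_of_dvd_mul_left hq2'))

variable {S : St}

/-- In a frame of a fundamental discriminant, `gcd(gcd(a, b), c) = 1` (`c = (Δ - b²)/4a`).
[cite: JacobsonWilliams2008, §4.1] -/
theorem Inv.gcd_gcd_c (hF : IsFundDisc Δ) (hI : Inv Δ S) : Int.gcd (Int.gcd S.a S.b) (S.c Δ) = 1 := by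
  apply hF.eq_one_of_dvd (a := S.a) (b := S.b) (c := S.c Δ)
  · linarith [hI.four_a_c]
  · exact (Int.gcd_dvd_left _ _).trans (Int.gcd_dvd_left _ _)
  · exact (Int.gcd_dvd_left _ _).trans (Int.gcd_dvd_right _ _)
  · exact Int.gcd_dvd_right _ _

/-! ### The squared frame -/

/-- `g = gcd(a, b)`. [cite: JacobsonWilliams2008, §5.4] -/
def St.g (S : St) : ℤ := Int.gcd S.a S.b

/-- `a' = a/g`. [cite: JacobsonWilliams2008, §5.4] -/
def St.a1 (S : St) : ℤ := S.a / S.g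

/-- `b' = b/g`. [cite: JacobsonWilliams2008, §5.4] -/
def St.b1 (S : St) : ℤ := S.b / S.g

/-- **The squared frame** `(A, B, p₂, r₂)`: `A = a'²`, `B = b + 2νa'c`,
`p₂ = κ·pp - b'λ·pr + a'λ·rr`, `r₂ = μ·pr + ν·rr` (`pp, pr, rr` the coordinate products), for
Bezout coefficients `μa' + νb' = 1`, `κg + λc = 1`. [cite: JacobsonWilliams2008, §5.4 (ideal products)] -/
def sq (Δ : ℕ) (S : St) (μ ν κ lam : ℤ) : St :=
  ⟨(S.a1 ^ 2).toNat, S.b + 2 * ν * S.a1 * S.c Δ,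
    lin 1 (S.a1 * lam) (lin κ (-(S.b1 * lam)) (omul Δ S.p S.p) (omul Δ S.p S.r)) (omul Δ S.r S.r),
    lin μ ν (omul Δ S.p S.r) (omul Δ S.r S.r)⟩

/-- `g ≥ 1`. [folklore] -/
theorem Inv.g_pos (hI : Inv Δ S) : 1 ≤ S.g := by
  unfold St.g
  have : 0 < Int.gcd (S.a : ℤ) S.b := Int.gcd_pos_of_ne_zero_left _ (by have := hI.1; omega)
  exact_mod_cast this

/-- `a = g a'`. [folklore] -/
theorem Inv.a_eq (_hI : Inv Δ S) : (S.a : ℤ) = S.g * S.a1 := by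
  unfold St.a1 St.g
  exact (Int.mul_ediv_cancel' (Int.gcd_dvd_left _ _)).symm

/-- `b = g b'`. [folklore] -/
theorem Inv.b_eq (_hI : Inv Δ S) : S.b = S.g * S.b1 := by
  unfold St.b1 St.g
  exact (Int.mul_ediv_cancel' (Int.gcd_dvd_right _ _)).symm

/-- `a' ≥ 1`. [folklore] -/
theorem Inv.a1_pos (hI : Inv Δ S) : 1 ≤ S.a1 := by
  have ha := hI.a_eq
  have hg := hI.g_pos
  have h1 : (1 : ℤ) ≤ S.a := by exact_mod_cast hI.1
  by_contra h
  push Not at h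
  nlinarith

/-- The new norm is `A = a'²`. [folklore] -/
theorem Inv.sq_a (_hI : Inv Δ S) (μ ν κ lam : ℤ) : ((sq Δ S μ ν κ lam).a : ℤ) = S.a1 ^ 2 := by
  show (((S.a1 ^ 2).toNat : ℕ) : ℤ) = S.a1 ^ 2
  exact Int.toNat_of_nonneg (by positivity)

/-- `β_t = (b + t)/2` satisfies `β² = bβ + ac` when `t² = Δ`. [cite: JacobsonWilliams2008, §5.4] -/
theorem Inv.beta_sq (hI : Inv Δ S) {t : ℝ} (ht : t ^ 2 = Δ) :
    ((S.b + t) / 2) ^ 2 = S.b * ((S.b + t) / 2) + S.a * S.c Δ := by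
  have hc : (4 : ℝ) * S.a * S.c Δ = Δ - S.b ^ 2 := by exact_mod_cast hI.four_a_c
  linear_combination (1 / 4 : ℝ) * ht - (1 / 4 : ℝ) * hc

section SqProof

variable (hΔ : IsDisc Δ) (hI : Inv Δ S) {μ ν κ lam : ℤ}
  (hμν : μ * S.a1 + ν * S.b1 = 1) (hκl : κ * S.g + lam * S.c Δ = 1)
include hΔ hI hμν hκl

omit hμν in
/-- `a² · ev p₂ = θ² · g a'²` (the identity `gA = κa² - b'λ·aβ + a'λ·β²` divided by `a²`).
[cite: JacobsonWilliams2008, §5.4] -/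
theorem Inv.sq_evP {t : ℝ} (ht : t ^ 2 = Δ) :
    (S.a : ℝ) ^ 2 * ev Δ t (sq Δ S μ ν κ lam).p = ev Δ t S.p ^ 2 * (S.g * S.a1 ^ 2) := by
  have hβ := hI.beta_sq ht
  have ha : (S.a : ℝ) = S.g * S.a1 := by exact_mod_cast hI.a_eq
  have hb : (S.b : ℝ) = S.g * S.b1 := by exact_mod_cast hI.b_eq
  have h5 : (κ : ℝ) * S.g + lam * S.c Δ = 1 := by exact_mod_cast hκl
  have hR : (S.a : ℝ) * ev Δ t S.r = ev Δ t S.p * ((S.b + t) / 2) := by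
    have := hI.2.2.1 t ht
    linear_combination (1 / 2 : ℝ) * this
  show (S.a : ℝ) ^ 2 * ev Δ t (lin 1 (S.a1 * lam) (lin κ (-(S.b1 * lam)) (omul Δ S.p S.p) (omul Δ S.p S.r))
    (omul Δ S.r S.r)) = _
  rw [ev_lin, ev_lin, ev_omul hΔ ht, ev_omul hΔ ht, ev_omul hΔ ht]
  set θ := ev Δ t S.p
  set R := ev Δ t S.r
  push_cast
  linear_combination (-(S.b1 * lam * S.a * θ)) * hR + (S.a1 * lam * (S.a * R + θ * ((S.b + t) / 2))) * hR
    + θ ^ 2 * ((S.a1 * lam) * hβ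
      + (-(lam * ((S.b + t) / 2) * S.b1) + κ * (S.a + S.g * S.a1) + S.a1 * lam * S.c Δ) * ha
      + (lam * ((S.b + t) / 2) * S.a1) * hb + (S.g * S.a1 ^ 2) * h5)

omit hκl in
/-- `a² · ev r₂ = θ² · g β_B` (the identity `gβ_B = μ·aβ + ν·β²` divided by `a²`),
`β_B = β + νa'c`. [cite: JacobsonWilliams2008, §5.4] -/
theorem Inv.sq_evR {t : ℝ} (ht : t ^ 2 = Δ) :
    (S.a : ℝ) ^ 2 * ev Δ t (sq Δ S μ ν κ lam).r =
      ev Δ t S.p ^ 2 * (S.g * ((S.b + t) / 2 + ν * S.a1 * S.c Δ)) := by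
  have hβ := hI.beta_sq ht
  have ha : (S.a : ℝ) = S.g * S.a1 := by exact_mod_cast hI.a_eq
  have hb : (S.b : ℝ) = S.g * S.b1 := by exact_mod_cast hI.b_eq
  have h4 : (μ : ℝ) * S.a1 + ν * S.b1 = 1 := by exact_mod_cast hμν
  have hR : (S.a : ℝ) * ev Δ t S.r = ev Δ t S.p * ((S.b + t) / 2) := by
    have := hI.2.2.1 t ht
    linear_combination (1 / 2 : ℝ) * this
  show (S.a : ℝ) ^ 2 * ev Δ t (lin μ ν (omul Δ S.p S.r) (omul Δ S.r S.r)) = _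
  rw [ev_lin, ev_omul hΔ ht, ev_omul hΔ ht]
  set θ := ev Δ t S.p
  set R := ev Δ t S.r
  linear_combination (μ * S.a * θ) * hR + (ν * (S.a * R + θ * ((S.b + t) / 2))) * hR
    + θ ^ 2 * (ν * hβ + (((S.b + t) / 2) * μ + ν * S.c Δ) * ha + (((S.b + t) / 2) * ν) * hb
      + (((S.b + t) / 2) * S.g) * h4)

/-- **Squaring preserves the frame invariant.** [cite: JacobsonWilliams2008, §5.4 (ideal products)] -/
theorem Inv.sq : Inv Δ (sq Δ S μ ν κ lam) := by
  have hA := hI.sq_a μ ν κ lam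
  have ha1 := hI.a1_pos
  have hg := hI.g_pos
  have haeq := hI.a_eq
  have hbeq := hI.b_eq
  have hc := hI.four_a_c
  refine ⟨?_, ?_, ?_, ?_⟩
  · have : (1 : ℤ) ≤ (Infra.sq Δ S μ ν κ lam).a := by rw [hA]; nlinarith
    exact_mod_cast this
  · -- `Δ - B² = 4A · c(gμ - ν²c)`
    rw [hA]
    show 4 * S.a1 ^ 2 ∣ (Δ : ℤ) - (S.b + 2 * ν * S.a1 * S.c Δ) ^ 2
    refine ⟨S.c Δ * (S.g * μ - ν ^ 2 * S.c Δ), ?_⟩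
    linear_combination (-1 : ℤ) * hc + (4 * S.c Δ) * haeq - (4 * S.c Δ * ν * S.a1) * hbeq
      - (4 * S.c Δ * S.g * S.a1) * hμν
  · intro t ht
    have H1 := hI.sq_evR hΔ hμν (κ := κ) (lam := lam) ht
    have H2 := hI.sq_evP hΔ (μ := μ) (ν := ν) hκl ht
    have hA' : (((Infra.sq Δ S μ ν κ lam).a : ℕ) : ℝ) = S.a1 ^ 2 := by exact_mod_cast hA
    have ha2 : (S.a : ℝ) ^ 2 ≠ 0 := by have := hI.a_pos; positivity
    apply mul_left_cancel₀ ha2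
    rw [hA']
    show (S.a : ℝ) ^ 2 * (ev Δ t (Infra.sq Δ S μ ν κ lam).r * (2 * S.a1 ^ 2)) =
      (S.a : ℝ) ^ 2 * (ev Δ t (Infra.sq Δ S μ ν κ lam).p * ((S.b + 2 * ν * S.a1 * S.c Δ : ℤ) + t))
    push_cast
    linear_combination (2 * S.a1 ^ 2) * H1 - ((S.b : ℝ) + 2 * ν * S.a1 * S.c Δ + t) * H2
  · -- spanning: `pp, pr, rr` lie in the span of `p₂, r₂`, and `p, r` lie in the span of those
    have ha2 : (S.a : ℝ) ^ 2 ≠ 0 := by have := hI.a_pos; positivity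
    have key : ∀ (x y : ℤ) (w : ℤ × ℤ), (S.a : ℝ) ^ 2 * ev Δ (rt Δ) w =
        (S.a : ℝ) ^ 2 * ev Δ (rt Δ) (lin x y (Infra.sq Δ S μ ν κ lam).p (Infra.sq Δ S μ ν κ lam).r) →
        w = lin x y (Infra.sq Δ S μ ν κ lam).p (Infra.sq Δ S μ ν κ lam).r :=
      fun x y w h => ev_injective (irrational_rt hΔ) (mul_left_cancel₀ ha2 h)
    have H1 := hI.sq_evR hΔ hμν (κ := κ) (lam := lam) (rt_sq Δ)
    have H2 := hI.sq_evP hΔ (μ := μ) (ν := ν) hκl (rt_sq Δ)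
    have hβ := hI.beta_sq (rt_sq Δ)
    have ha : (S.a : ℝ) = S.g * S.a1 := by exact_mod_cast haeq
    have hb : (S.b : ℝ) = S.g * S.b1 := by exact_mod_cast hbeq
    have h4 : (μ : ℝ) * S.a1 + ν * S.b1 = 1 := by exact_mod_cast hμν
    have hR : (S.a : ℝ) * ev Δ (rt Δ) S.r = ev Δ (rt Δ) S.p * ((S.b + rt Δ) / 2) := by
      have := hI.2.2.1 _ (rt_sq Δ)
      linear_combination (1 / 2 : ℝ) * this
    set P := (Infra.sq Δ S μ ν κ lam).p
    set Q := (Infra.sq Δ S μ ν κ lam).r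
    set θ := ev Δ (rt Δ) S.p
    set R := ev Δ (rt Δ) S.r
    -- `pp = g • p₂`
    have hpp : omul Δ S.p S.p = lin S.g 0 P Q := by
      apply key
      rw [ev_lin, ev_omul hΔ (rt_sq Δ)]
      push_cast
      linear_combination (-(S.g : ℝ)) * H2 + θ ^ 2 * (S.a + S.g * S.a1) * ha
    -- `pr = a' • r₂ - νc • p₂`
    have hpr : omul Δ S.p S.r = lin (-(ν * S.c Δ)) S.a1 P Q := by
      apply key
      rw [ev_lin, ev_omul hΔ (rt_sq Δ)]
      push_cast
      linear_combination (θ * S.a) * hR + (θ ^ 2 * ((S.b + rt Δ) / 2)) * ha + (ν * S.c Δ) * H2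
        - (S.a1 : ℝ) * H1
    -- `rr = b' • r₂ + μc • p₂`
    have hrr : omul Δ S.r S.r = lin (μ * S.c Δ) S.b1 P Q := by
      apply key
      rw [ev_lin, ev_omul hΔ (rt_sq Δ)]
      push_cast
      linear_combination (S.a * R + θ * ((S.b + rt Δ) / 2)) * hR + θ ^ 2 * hβ
        + (θ ^ 2 * ((S.b + rt Δ) / 2)) * hb + (θ ^ 2 * S.c Δ) * ha
        - (θ ^ 2 * S.g * S.a1 * S.c Δ) * h4 - (μ * S.c Δ) * H2 - (S.b1 : ℝ) * H1
    -- `p = x₀ pp + y₀ pr`, `r = x₀ pr + y₀ rr` where `(1, 0) = x₀ p + y₀ r`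
    obtain ⟨x₀, y₀, h10⟩ := hI.2.2.2 (1, 0)
    have hp : S.p = lin x₀ y₀ (omul Δ S.p S.p) (omul Δ S.p S.r) := by
      rw [← omul_lin, ← h10, omul_one]
    have hr' : S.r = lin x₀ y₀ (omul Δ S.p S.r) (omul Δ S.r S.r) := by
      rw [omul_comm Δ S.p S.r, ← omul_lin, ← h10, omul_one]
    rw [hpp, hpr, lin_lin] at hp
    rw [hpr, hrr, lin_lin] at hr'
    exact Spans.of_mem hI.2.2.2 hp hr'

omit hμν in
/-- **`θ' = θ²/g`**: the new `θ` in the form `g · ev p₂ = θ²`. [cite: JacobsonWilliams2008, §5.4] -/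
theorem Inv.ev_sq_p {t : ℝ} (ht : t ^ 2 = Δ) :
    (S.g : ℝ) * ev Δ t (Infra.sq Δ S μ ν κ lam).p = ev Δ t S.p ^ 2 := by
  have H2 := hI.sq_evP hΔ (μ := μ) (ν := ν) hκl ht
  have ha : (S.a : ℝ) = S.g * S.a1 := by exact_mod_cast hI.a_eq
  have ha2 : (S.a : ℝ) ^ 2 ≠ 0 := by have := hI.a_pos; positivity
  apply mul_left_cancel₀ ha2
  linear_combination (S.g : ℝ) * H2 - ev Δ t S.p ^ 2 * (S.a + S.g * S.a1) * ha

end SqProof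

/-- For a reduced frame the new norm `A = a'² ≤ a² < Δ`. [cite: JacobsonWilliams2008, §5.4] -/
theorem Inv.sq_a_lt (hI : Inv Δ S) (hR : Red Δ S) (μ ν κ lam : ℤ) :
    ((Infra.sq Δ S μ ν κ lam).a : ℝ) < Δ := by
  have hA : (((Infra.sq Δ S μ ν κ lam).a : ℕ) : ℝ) = S.a1 ^ 2 := by exact_mod_cast hI.sq_a μ ν κ lam
  have ha : (S.a : ℝ) = S.g * S.a1 := by exact_mod_cast hI.a_eq
  have hg : (1 : ℝ) ≤ S.g := by exact_mod_cast hI.g_pos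
  have ha1 : (1 : ℝ) ≤ S.a1 := by exact_mod_cast hI.a1_pos
  have halt := hR.a_lt_rt
  have hs := rt_sq Δ
  rw [hA]
  have h1 : (S.a1 : ℝ) ≤ S.a := by rw [ha]; nlinarith
  have h2 : (S.a : ℝ) ^ 2 < Δ := by rw [← hs]; have := hI.a_pos; nlinarith
  nlinarith

end Literature.NumberTheory.QuadraticFields.Infra

end
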